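/-
Copyright (c) 2026 the pub-hodgecm-mathlib formalisation cell (harness21).  Prover seat hodgecm-mathlib-F0P3a-p07 (g11): road «S3-tree» (LEAD F0P3a-plan (g11), architect
A-p16 (g29) ruling A-81 (1) «SPAN-0-ram»: (c) the CM dress at a tamely ramified place), brick «SPAN-0-ram»; 2026-09-01.
§3–§4 are ADAPTED from ★ F0P2-p06 (g10) `UnitaryVertexStabilizerSpanSelfDualCM` §1–§2 and `UnitaryVertexStabilizerSpanSelfDualStdCM` §1, §3 (credited below).
-/
import Literature.NumberTheory.Rogawski1990.UnitaryVertexStabilizerSpanSelfDualStdCM              -- ★ p846189 F0P2-p06 (g10): `mem_cmLocalIntegralLevel_iff_mapGL_stdLattice_eq`, `tsupport_comp_conj_subset_preimage`; brings ★ `span_of_cover`, ★ S-c FILE A, ★ FrameChange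
import Literature.NumberTheory.Automorphic.UnitaryLatticeTreeTypeTwoUnipotentFixedNeighbourRamified    -- ★ p846202 (this seat) S-a3-ram: `exists_isSelfDualLattice_gt_mapGL_eq_of_charpoly_of_neg`
import Literature.NumberTheory.Automorphic.UnitaryLatticeTreeTypeTwoTransitiveRamified               -- ★ p846262 (this seat) htr₂-ram: `forall_isVertexLattice_two_exists_mapGL_N₁_eq_of_neg`
import Literature.NumberTheory.Automorphic.UnitaryLatticeTreeSelfDualTransitiveOfTrace               -- ★ p846267 (this seat) htr₀ datum-free: `exists_unitary_mapGL_stdLattice_eq_of_isSelfDualLattice_of_trace`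
import Literature.NumberTheory.Automorphic.UnitaryGroupLevelTransport                                -- ★ `unitaryGroupOfForm_smul_of_isUnit` (`U(cH) = U(H)`)
import HarnessLib

/-!
# «SPAN-0-ram»: the pieces on SELF-DUAL vertex stabilisers at a TAMELY RAMIFIED non-split place — the CM dress of ★ S-a3-ram ∕ ★ htr₂-ram ∕ ★ htr₀
# (Bruhat–Tits 1972 §10; Rogawski 1990 §4.9 Lemma 4.9.3; Jacobowitz 1962 §8)

Topic `NumberTheory/Rogawski1990`; namespace `Literature.NumberTheory.Rogawski1990`.  THEOREMS ONLY (no definition, no instance, no notation, no named fact, no `sorry`); kernel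
lane.  Cell `pub/hodgecm-mathlib` (D-0151), crux H413 = `stmt-HodgeConjecture-24833`; road «S3-tree», architect A-p16 (g29) A-81 (1)(c): the sibling of ★ `span_isSelfDual` ∕
★ `span_isSelfDual_std` (F0P2-p06 (g10), places `v` UNRAMIFIED in `L`) at a place `v` of `L⁺` non-split and TAMELY RAMIFIED in the CM field `L`.
THE TWO LOCAL BLOCKS (carried as HYPOTHESES here, exactly as ★ `span_isSelfDual` carries `hv : IsUnramifiedIn`; their producers at the completion are booked END-side):
(R) the RAMIFIED BLOCK at `w`: a uniformiser `ϖ` of `L_w` with `σ_w ϖ = −ϖ`, `σ_w` trivial on the residue field (`|σ_w x − x| < 1` on `𝒪_w`), `|2|_w = 1` (tameness), and the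
(norm) property of `σ_w`-fixed `1`-units (Hensel in `L⁺_v`, odd residue characteristic); (F) the GOOD-REDUCTION FRAME at `w`: `H′_w = c·(σ_w A)ᵀ J₀ A` with `A ∈ GL₃(𝒪_w)` and a unit
`c` — at a ramified `w` unimodular rank-3 hermitian lattices come in TWO classes (discriminant in `𝒪_v^× ∕ 𝒪_v^{×2}`), so the scalar `c` cannot be dropped in general; it is
harmless: `U(cH) = U(H)` (★ `unitaryGroupOfForm_smul_of_isUnit`) and the vertex predicates are `c`-invariant (§1 `isVertexLattice_smul_iff`).
THE MATHEMATICS.  (§2) THE COVER: every residually unipotent `δ ∈ U(H′)(L⁺_v)` fixes a SELF-DUAL vertex of `(L_w³, σ_w, H′_w)` — ★ S-c FILE A gives some fixed vertex of type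
`d ∈ {0,2}` (★ T1b); for `d = 2`, ★ S-a3-ram (`exists_isSelfDualLattice_gt_mapGL_eq_of_charpoly_of_neg`) with its `htr₂` DISCHARGED by ★ htr₂-ram
(`forall_isVertexLattice_two_exists_mapGL_N₁_eq_of_neg`), transported to the frame by ★ `exists_isSelfDualLattice_gt_mapGL_eq_of_charpoly_formCongr` and the scalar `c` by §1.
(§3) SELF-DUAL TRANSITIVITY AT `H′_w`: ★ htr₀ (`exists_unitary_mapGL_stdLattice_eq_of_isSelfDualLattice_of_trace`, datum-free, trace element `1∕2`) through the frame.
(§4) «SPAN-0-ram» = ★ `span_of_cover` at `P := IsSelfDualLattice σ_w ϖ H′_w (latt ·)` over §2, and its re-centring at `K_std` exactly as ★ `span_isSelfDual_std`.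
HONEST LABEL: HC_CM is proved only modulo the 2 remaining named inputs (hLiu418 24832, h413 24833) until rung 0 closes; nothing printed is asserted here; S3 (`stub_N6nsS3id`)
stays a print row until the road's END lands; the blocks (R), (F) are hypotheses of every theorem below.

* §1 `isIntMatrix_smul_iff_of_v_eq_one`, **`isVertexLattice_smul_iff`** (vertex predicates are invariant under unit scalars of the form).
* §2 **`exists_isSelfDualLattice_mapGL_localNonsplitEquiv_eq_of_charpoly_of_neg`** (the self-dual cover at a tamely ramified `w`).
* §3 **`exists_local_mapGL_stdLattice_eq_of_isSelfDualLattice_of_frame`** (self-dual transitivity at `H′_w` from a scaled frame and `|2|_w = 1`).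
* §4 **`span_isSelfDual_of_neg`**, **`span_isSelfDual_std_of_neg`**.

## References
* [BruhatTits1972] F. Bruhat, J. Tits, *Groupes réductifs sur un corps local I*, Publ. Math. IHÉS 41 (1972), §10.
* [Rogawski1990] J. D. Rogawski, *Automorphic Representations of Unitary Groups in Three Variables*, Ann. of Math. Stud. 123 (1990), §4.9 Lemma 4.9.3 p. 56.
* [Jacobowitz1962] R. Jacobowitz, *Hermitian forms over local fields*, Amer. J. Math. 84 (1962), §8 (ramified non-dyadic unimodular lattices: rank and discriminant).
* [LanglandsShelstad1990Descent] R. Langlands, D. Shelstad, *Descent for transfer factors* (1990), §2.1.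
-/

set_option autoImplicit false

noncomputable section

open scoped Valued WithZero Matrix MatrixGroups
open Topology Set NumberField IsDedekindDomain Matrix

/-! ## §1 Vertex predicates under a unit scalar of the form -/

namespace Literature.NumberTheory.Automorphic.UnitaryLatticeTree

open Literature.NumberTheory.Automorphic Literature.NumberTheory.Automorphic.HermitianLattice

variable {K : Type*} [Field K] [Valued K ℤᵐ⁰] {σ : K →+* K} {ϖ : K} {N : ℕ}

/-- Integrality of a matrix is invariant under a unit scalar. [cite: Jacobowitz1962, §4] -/
theorem isIntMatrix_smul_iff_of_v_eq_one {c : K} (hc : Valued.v c = 1) (A : Matrix (Fin N) (Fin N) K) : IsIntMatrix (c • A) ↔ IsIntMatrix A := by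
  refine forall_congr' fun i => forall_congr' fun j => ?_
  rw [Matrix.smul_apply, smul_eq_mul, map_mul, hc, one_mul]

/-- **Vertex predicates are invariant under a unit scalar of the form**: `IsVertexLattice σ ϖ (c·H) d M ↔ IsVertexLattice σ ϖ H d M` for `|c| = 1` (the Gram matrix scales by
`c`, its inverse by `c⁻¹`, its determinant by `c^N`).  Needed at RAMIFIED places, where a good-reduction form is `c·(σA)ᵀJ₀A` with `c` a unit that is not a norm in general.
[cite: Jacobowitz1962, §4, §8] -/
theorem isVertexLattice_smul_iff {c : K} (hc : Valued.v c = 1) (H : Matrix (Fin N) (Fin N) K) (d : ℕ) (M : Submodule 𝒪[K] (Fin N → K)) :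
    IsVertexLattice σ ϖ (c • H) d M ↔ IsVertexLattice σ ϖ H d M := by
  have hc0 : c ≠ 0 := fun h => by rw [h, map_zero] at hc; exact zero_ne_one hc
  have hsmul : ∀ g : GL (Fin N) K, formCongr σ g (c • H) = c • formCongr σ g H := fun g => by
    simp only [formCongr, Matrix.mul_smul, Matrix.smul_mul]
  -- the inverse of `c • G`
  have hinv : ∀ G : Matrix (Fin N) (Fin N) K, (c • G)⁻¹ = c⁻¹ • G⁻¹ := by
    intro G
    by_cases hG : IsUnit G.det
    · exact Matrix.inv_eq_left_inv (by rw [Matrix.smul_mul, Matrix.mul_smul, smul_smul, inv_mul_cancel₀ hc0, one_smul, Matrix.nonsing_inv_mul _ hG])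
    · have hcG : ¬IsUnit (c • G).det := by
        rw [Matrix.det_smul, isUnit_iff_ne_zero, mul_ne_zero_iff, not_and_or, ← isUnit_iff_ne_zero, ← isUnit_iff_ne_zero]
        exact Or.inr hG
      rw [Matrix.nonsing_inv_apply_not_isUnit _ hG, Matrix.nonsing_inv_apply_not_isUnit _ hcG, smul_zero]
  have hcinv : Valued.v c⁻¹ = 1 := by rw [map_inv₀, hc, inv_one]
  have hdet : ∀ G : Matrix (Fin N) (Fin N) K, Valued.v (c • G).det = Valued.v G.det := fun G => by
    rw [Matrix.det_smul, map_mul, map_pow, hc, one_pow, one_mul]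
  constructor
  · rintro ⟨g, hM, hG, hG', hGdet⟩
    rw [hsmul] at hG hG' hGdet
    refine ⟨g, hM, (isIntMatrix_smul_iff_of_v_eq_one hc _).1 hG, ?_, by rwa [hdet] at hGdet⟩
    rw [hinv, smul_comm] at hG'
    exact (isIntMatrix_smul_iff_of_v_eq_one hcinv _).1 hG'
  · rintro ⟨g, hM, hG, hG', hGdet⟩
    refine ⟨g, hM, ?_, ?_, ?_⟩
    · rw [hsmul]; exact (isIntMatrix_smul_iff_of_v_eq_one hc _).2 hG
    · rw [hsmul, hinv, smul_comm]; exact (isIntMatrix_smul_iff_of_v_eq_one hcinv _).2 hG'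
    · rw [hsmul, hdet]; exact hGdet

end Literature.NumberTheory.Automorphic.UnitaryLatticeTree

namespace Literature.NumberTheory.Rogawski1990

open Literature.NumberTheory.Automorphic Literature.NumberTheory.Automorphic.UnitaryGroup Literature.NumberTheory.GaloisRepresentations
open Literature.NumberTheory.Automorphic.UnitaryLatticeTree Literature.NumberTheory.Automorphic.HermitianLattice

variable (L : Type) [Field L] [NumberField L] [IsCMField L] (H' : Matrix (Fin 3) (Fin 3) L) (v : HeightOneSpectrum (𝓞 ↥(maximalRealSubfield L)))
  (w : PlacesOver L v) (hw : IsCMField.complexConj L • w.1 = w.1)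

/-! ## §2 The self-dual cover at a tamely ramified place -/

/-- **EVERY RESIDUALLY UNIPOTENT `δ ∈ U(H′)(L⁺_v)` FIXES A SELF-DUAL VERTEX — TAMELY RAMIFIED `w`** (blocks (R), (F) as hypotheses): if `|coeff_i charpoly(e δ) − coeff_i charpoly 1| < 1`
for `i < 3` then `∃ g, IsSelfDualLattice σ_w ϖ (placeForm H′ w.1) (latt g) ∧ e(δ)·latt g = latt g`.  ★ S-c FILE A «some vertex» + (F) + §1 + ★ T1b types `{0,2}` + ★ S-a3-ram with ★ htr₂-ram,
transported by ★ `exists_isSelfDualLattice_gt_mapGL_eq_of_charpoly_formCongr`.  (Sibling of ★ `exists_isSelfDualLattice_mapGL_localNonsplitEquiv_eq_of_charpoly_of_datum`.)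
[cite: BruhatTits1972, §10] [cite: Rogawski1990, §4.9 Lemma 4.9.3 p. 56] [cite: Jacobowitz1962, §8] -/
theorem exists_isSelfDualLattice_mapGL_localNonsplitEquiv_eq_of_charpoly_of_neg
    (hH' : (H'.map (cmConjRingHom L))ᵀ = H') (hdet' : H'.det ≠ 0)
    {ϖ : w.1.adicCompletion L} (hϖ : Valued.v ϖ = WithZero.exp (-1 : ℤ)) (hσϖ : galAdicCompletionMap (L := L) (IsCMField.complexConj L) hw ϖ = -ϖ)
    (hres : ∀ x : w.1.adicCompletion L, Valued.v x ≤ 1 → Valued.v (galAdicCompletionMap (L := L) (IsCMField.complexConj L) hw x - x) < 1) (h2 : Valued.v (2 : w.1.adicCompletion L) = 1)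
    (hnorm : ∀ u : w.1.adicCompletion L, galAdicCompletionMap (L := L) (IsCMField.complexConj L) hw u = u → Valued.v (u - 1) < 1 →
      ∃ z : w.1.adicCompletion L, z * galAdicCompletionMap (L := L) (IsCMField.complexConj L) hw z = u ∧ Valued.v (z - 1) ≤ Valued.v (u - 1))
    (A : GL (Fin 3) (w.1.adicCompletion L)) {c : w.1.adicCompletion L} (hc : Valued.v c = 1)
    (hA : placeForm H' w.1 = c • formCongr (galAdicCompletionMap (L := L) (IsCMField.complexConj L) hw) A ((StdForm.antidiagonal 3).over (w.1.adicCompletion L)))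
    (δ : (cmDatum L 3 H').Local v)
    (hδ1 : ∀ i < 3, Valued.v ((((localNonsplitEquiv (IsCMField.complexConj L) H' (IsCMField.complexConj_ne_one L) w hw δ :
        ↥(unitaryGroupOfForm (galAdicCompletionMap (L := L) (IsCMField.complexConj L) hw) (placeForm H' w.1))) :
          GL (Fin 3) (w.1.adicCompletion L)) : Matrix (Fin 3) (Fin 3) (w.1.adicCompletion L)).charpoly.coeff i -
        (1 : Matrix (Fin 3) (Fin 3) (w.1.adicCompletion L)).charpoly.coeff i) < 1) :
    ∃ g : GL (Fin 3) (w.1.adicCompletion L),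
      IsSelfDualLattice (galAdicCompletionMap (L := L) (IsCMField.complexConj L) hw) ϖ (placeForm H' w.1)
        (latt (g : Matrix (Fin 3) (Fin 3) (w.1.adicCompletion L))) ∧
      mapGL ((localNonsplitEquiv (IsCMField.complexConj L) H' (IsCMField.complexConj_ne_one L) w hw δ :
          ↥(unitaryGroupOfForm (galAdicCompletionMap (L := L) (IsCMField.complexConj L) hw) (placeForm H' w.1))) :
            GL (Fin 3) (w.1.adicCompletion L)) (latt (g : Matrix (Fin 3) (Fin 3) (w.1.adicCompletion L))) =
        latt (g : Matrix (Fin 3) (Fin 3) (w.1.adicCompletion L)) := by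
  set u := (localNonsplitEquiv (IsCMField.complexConj L) H' (IsCMField.complexConj_ne_one L) w hw δ :
    ↥(unitaryGroupOfForm (galAdicCompletionMap (L := L) (IsCMField.complexConj L) hw) (placeForm H' w.1))) with hu
  have hσσ : ∀ x, galAdicCompletionMap (L := L) (IsCMField.complexConj L) hw (galAdicCompletionMap (L := L) (IsCMField.complexConj L) hw x) = x :=
    galAdicCompletionMap_galAdicCompletionMap_of_smul_eq (IsCMField.complexConj L) w (IsCMField.complexConj_ne_one L) hw
  have hvσ : ∀ x, Valued.v (galAdicCompletionMap (L := L) (IsCMField.complexConj L) hw x) = Valued.v x := fun x => valued_galAdicCompletionMap (L := L) (IsCMField.complexConj L) hw x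
  have hc0 : c ≠ 0 := fun h => by rw [h, map_zero] at hc; exact zero_ne_one hc
  have hUeq : unitaryGroupOfForm (galAdicCompletionMap (L := L) (IsCMField.complexConj L) hw) (formCongr (galAdicCompletionMap (L := L) (IsCMField.complexConj L) hw) A ((StdForm.antidiagonal 3).over (w.1.adicCompletion L))) =
      unitaryGroupOfForm (galAdicCompletionMap (L := L) (IsCMField.complexConj L) hw) (placeForm H' w.1) := by
    rw [hA, unitaryGroupOfForm_smul_of_isUnit _ (isUnit_iff_ne_zero.2 hc0)]
  -- (1) SOME fixed vertex, of type `d`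
  obtain ⟨g, ⟨d, hdg⟩, hfix⟩ := exists_isVertex_mapGL_localNonsplitEquiv_eq_of_charpoly L v w hw H' hH' hdet' hϖ δ
    (v_charpoly_coeff_le_one_of_residuallyUnipotent _ hδ1)
  -- (2) read it in the frame `J₀` (block (F) and §1)
  have hdg' : IsVertexLattice (galAdicCompletionMap (L := L) (IsCMField.complexConj L) hw) ϖ
      (formCongr (galAdicCompletionMap (L := L) (IsCMField.complexConj L) hw) A ((StdForm.antidiagonal 3).over (w.1.adicCompletion L))) d
      (latt (g : Matrix (Fin 3) (Fin 3) (w.1.adicCompletion L))) := by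
    have h := hdg
    rw [hA] at h
    exact (isVertexLattice_smul_iff hc _ d _).1 h
  -- (3) `d ∈ {0, 2}`
  rcases type_eq_zero_or_two_of_isVertexLattice_three hvσ hϖ (v_det_antidiagonal_three_eq_one (w.1.adicCompletion L))
      ((isVertexLattice_formCongr_iff A _ d _).1 hdg') with rfl | rfl
  · exact ⟨g, hdg, hfix⟩
  · -- (4) type two: ★ S-a3-ram at `J₀` with ★ htr₂-ram, transported to the frame, gives a fixed self-dual neighbour
    have huU : (u : GL (Fin 3) (w.1.adicCompletion L)) ∈
        unitaryGroupOfForm (galAdicCompletionMap (L := L) (IsCMField.complexConj L) hw)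
          (formCongr (galAdicCompletionMap (L := L) (IsCMField.complexConj L) hw) A ((StdForm.antidiagonal 3).over (w.1.adicCompletion L))) := by
      rw [hUeq]; exact u.2
    obtain ⟨M, hM, -, hMfix⟩ := exists_isSelfDualLattice_gt_mapGL_eq_of_charpoly_formCongr A
      (fun _ hδ' hδ1' _ hN hδN => exists_isSelfDualLattice_gt_mapGL_eq_of_charpoly_of_neg hvσ hσϖ hϖ hres
        (forall_isVertexLattice_two_exists_mapGL_N₁_eq_of_neg hσσ hvσ hϖ hσϖ hres h2 hnorm) hδ' hδ1' hN hδN)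
      huU (forall_v_charpoly_sub_lt_one_of_lt_three _ hδ1) hdg' hfix
    obtain ⟨g', hMg', -⟩ := id hM
    refine ⟨g', ?_, ?_⟩
    · rw [hA, ← hMg']; exact (isVertexLattice_smul_iff hc _ 0 _).2 hM
    · rw [← hMg']; exact hMfix

/-! ## §3 Self-dual transitivity at `H′_w` from a scaled frame -/

/-- **SELF-DUAL TRANSITIVITY AT `H′_w` FROM A SCALED FRAME** (`H′_w = c·(σ_w A)ᵀJ₀A`, `A ∈ GL₃(𝒪_w)`, `|c| = 1`; `|2|_w = 1`): every self-dual vertex `M` of `(L_w³, σ_w, H′_w)` is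
`e(x)·𝒪_w³` for some `x ∈ U(H′)(L⁺_v)` — `A·M` is `J₀`-self-dual (§1 + ★ frame change), hence `u₀·𝒪³` by ★ htr₀ (datum-free, trace element `1∕2`), and `x = e⁻¹(A⁻¹u₀A)`.
(Sibling of ★ `exists_local_mapGL_stdLattice_eq_of_isSelfDualLattice`.) [cite: Jacobowitz1962, §8] [cite: BruhatTits1972, §10] -/
theorem exists_local_mapGL_stdLattice_eq_of_isSelfDualLattice_of_frame
    (A : GL (Fin 3) (w.1.adicCompletion L)) (hAint : A ∈ glInt 3 (w.1.adicCompletion L)) {c : w.1.adicCompletion L} (hc : Valued.v c = 1)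
    (hA : placeForm H' w.1 = c • formCongr (galAdicCompletionMap (L := L) (IsCMField.complexConj L) hw) A ((StdForm.antidiagonal 3).over (w.1.adicCompletion L)))
    (h2 : Valued.v (2 : w.1.adicCompletion L) = 1)
    {ϖ : w.1.adicCompletion L} {M : Submodule 𝒪[w.1.adicCompletion L] (Fin 3 → w.1.adicCompletion L)}
    (hM : IsSelfDualLattice (galAdicCompletionMap (L := L) (IsCMField.complexConj L) hw) ϖ (placeForm H' w.1) M) :
    ∃ x : (cmDatum L 3 H').Local v,
      mapGL ((localNonsplitEquiv (IsCMField.complexConj L) H' (IsCMField.complexConj_ne_one L) w hw x :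
          ↥(unitaryGroupOfForm (galAdicCompletionMap (L := L) (IsCMField.complexConj L) hw) (placeForm H' w.1))) :
        GL (Fin 3) (w.1.adicCompletion L)) (stdLattice (w.1.adicCompletion L) 3) = M := by
  set e := localNonsplitEquiv (IsCMField.complexConj L) H' (IsCMField.complexConj_ne_one L) w hw with he
  have hσσ : ∀ x, galAdicCompletionMap (L := L) (IsCMField.complexConj L) hw (galAdicCompletionMap (L := L) (IsCMField.complexConj L) hw x) = x :=
    galAdicCompletionMap_galAdicCompletionMap_of_smul_eq (IsCMField.complexConj L) w (IsCMField.complexConj_ne_one L) hw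
  have hvσ : ∀ x, Valued.v (galAdicCompletionMap (L := L) (IsCMField.complexConj L) hw x) = Valued.v x := fun x => valued_galAdicCompletionMap (L := L) (IsCMField.complexConj L) hw x
  have hc0 : c ≠ 0 := fun h => by rw [h, map_zero] at hc; exact zero_ne_one hc
  have h20 : (2 : w.1.adicCompletion L) ≠ 0 := fun h => by rw [h, map_zero] at h2; exact zero_ne_one h2
  obtain ⟨ϖ₀, hϖ₀⟩ := exists_uniformizer_adicCompletion L v w
  -- `A·M` is self-dual for `J₀`, hence `u₀·𝒪³`
  have hM' : IsSelfDualLattice (galAdicCompletionMap (L := L) (IsCMField.complexConj L) hw) ϖ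
      (formCongr (galAdicCompletionMap (L := L) (IsCMField.complexConj L) hw) A ((StdForm.antidiagonal 3).over (w.1.adicCompletion L))) M := by
    have h := hM
    rw [hA] at h
    exact (isVertexLattice_smul_iff hc _ 0 _).1 h
  obtain ⟨u₀, hu₀⟩ := exists_unitary_mapGL_stdLattice_eq_of_isSelfDualLattice_of_trace hσσ hvσ hϖ₀
    ⟨1 / 2, by rw [map_div₀, map_one, h2, div_one], by rw [map_div₀, map_one, map_ofNat, ← add_div, one_add_one_eq_two, div_self h20]⟩
    ((isSelfDualLattice_formCongr_iff A _ M).1 hM')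
  -- `A⁻¹ u₀ A ∈ U(H′_w)` and `A⁻¹·𝒪³ = 𝒪³`
  have hmem : A⁻¹ * (u₀ : GL (Fin 3) (w.1.adicCompletion L)) * A ∈
      unitaryGroupOfForm (galAdicCompletionMap (L := L) (IsCMField.complexConj L) hw) (placeForm H' w.1) := by
    rw [hA, unitaryGroupOfForm_smul_of_isUnit _ (isUnit_iff_ne_zero.2 hc0), ← conj_mem_unitaryGroupOfForm_iff]
    rw [show A * (A⁻¹ * (u₀ : GL (Fin 3) (w.1.adicCompletion L)) * A) * A⁻¹ = (u₀ : GL (Fin 3) (w.1.adicCompletion L)) by group]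
    exact u₀.2
  have hAstd : mapGL A (stdLattice (w.1.adicCompletion L) 3) = stdLattice (w.1.adicCompletion L) 3 := by
    rw [mapGL_stdLattice_eq_iff]
    have h := (mem_glInt_iff _).1 hAint
    rw [forall_mem_integer_iff_isIntMatrix, forall_mem_integer_iff_isIntMatrix] at h
    exact h
  refine ⟨e.symm ⟨_, hmem⟩, ?_⟩
  rw [he, ContinuousMulEquiv.apply_symm_apply]
  change mapGL (A⁻¹ * (u₀ : GL (Fin 3) (w.1.adicCompletion L)) * A) (stdLattice (w.1.adicCompletion L) 3) = M
  rw [mapGL_mul, hAstd, mapGL_mul, hu₀, mapGL_inv_mapGL]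

/-! ## §4 «SPAN-0-ram» and its re-centring at `K_std` -/

section Span

variable [iM' : ∀ γ : (cmDatum L 3 H').Local v, MeasurableSpace ((cmDatum L 3 H').Local v ⧸ Subgroup.centralizer ({γ} : Set ((cmDatum L 3 H').Local v)))]
  [iB' : ∀ γ : (cmDatum L 3 H').Local v, BorelSpace ((cmDatum L 3 H').Local v ⧸ Subgroup.centralizer ({γ} : Set ((cmDatum L 3 H').Local v)))]

/-- **«SPAN-0-ram» (A-81 (1)(c)): at a non-split place `v` TAMELY RAMIFIED in `L` — blocks (R), (F) as hypotheses — in place of «unramified + good reduction», every `φ ∈ C_c^∞(U(H′)(L⁺_v))` has finitely many pieces `g k`,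
each smooth, supported in a COMPACT OPEN stabiliser `K k` of a SELF-DUAL vertex lattice `latt g_k` and `Ad(K k)`-invariant, with `Σᶠ_c Δ(γH, out c)·Φ(c, φ) = Σ_k Σᶠ_c Δ·Φ(c, g k)`
for all `G`-regular `γH` near `1`** — ★ `span_of_cover` at `P := IsSelfDualLattice σ_w ϖ H′_w (latt ·)` over the §1 cover.  This is the END-contract stub «SPAN» with the
self-dual `IsVertexStab` text of A-66 (1). [cite: Rogawski1990, §4.9 Lemma 4.9.3 p. 56] [cite: LanglandsShelstad1990Descent, §2.1] [cite: BruhatTits1972, §10] -/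
theorem span_isSelfDual_of_neg (hH' : (H'.map (cmConjRingHom L))ᵀ = H') (hdet' : H'.det ≠ 0)
    {ϖ : w.1.adicCompletion L} (hϖ : Valued.v ϖ = WithZero.exp (-1 : ℤ)) (hσϖ : galAdicCompletionMap (L := L) (IsCMField.complexConj L) hw ϖ = -ϖ)
    (hres : ∀ x : w.1.adicCompletion L, Valued.v x ≤ 1 → Valued.v (galAdicCompletionMap (L := L) (IsCMField.complexConj L) hw x - x) < 1) (h2 : Valued.v (2 : w.1.adicCompletion L) = 1)
    (hnorm : ∀ u : w.1.adicCompletion L, galAdicCompletionMap (L := L) (IsCMField.complexConj L) hw u = u → Valued.v (u - 1) < 1 →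
      ∃ z : w.1.adicCompletion L, z * galAdicCompletionMap (L := L) (IsCMField.complexConj L) hw z = u ∧ Valued.v (z - 1) ≤ Valued.v (u - 1))
    (A : GL (Fin 3) (w.1.adicCompletion L)) {c : w.1.adicCompletion L} (hc : Valued.v c = 1)
    (hA : placeForm H' w.1 = c • formCongr (galAdicCompletionMap (L := L) (IsCMField.complexConj L) hw) A ((StdForm.antidiagonal 3).over (w.1.adicCompletion L)))
    (T : LocalTransferFactor L H' v) {mG : OrbitalMeasureFamily ((cmDatum L 3 H').Local v)}
    (hmG : mG.IsAdmissibleOn fun γ' => IsRegularElt (γ'.val : GL (Fin 3) (LocalRing L v)))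
    (φ : (cmDatum L 3 H').Local v → ℂ) (hφ : IsLocSmooth φ) :
    ∃ (n : ℕ) (K : Fin n → Subgroup ((cmDatum L 3 H').Local v)) (g : Fin n → (cmDatum L 3 H').Local v → ℂ),
      (∀ k, ∃ gk : GL (Fin 3) (w.1.adicCompletion L),
        IsSelfDualLattice (galAdicCompletionMap (L := L) (IsCMField.complexConj L) hw) ϖ (placeForm H' w.1) (latt (gk : Matrix (Fin 3) (Fin 3) (w.1.adicCompletion L))) ∧
        IsCompact (K k : Set ((cmDatum L 3 H').Local v)) ∧ IsOpen (K k : Set ((cmDatum L 3 H').Local v)) ∧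
        ∀ u : (cmDatum L 3 H').Local v, u ∈ K k ↔
          mapGL ((localNonsplitEquiv (IsCMField.complexConj L) H' (IsCMField.complexConj_ne_one L) w hw u :
              ↥(unitaryGroupOfForm (galAdicCompletionMap (L := L) (IsCMField.complexConj L) hw) (placeForm H' w.1))) :
            GL (Fin 3) (w.1.adicCompletion L)) (latt (gk : Matrix (Fin 3) (Fin 3) (w.1.adicCompletion L))) = latt (gk : Matrix (Fin 3) (Fin 3) (w.1.adicCompletion L))) ∧
      (∀ k, IsLocSmooth (g k)) ∧ (∀ k, tsupport (g k) ⊆ (K k : Set ((cmDatum L 3 H').Local v))) ∧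
      (∀ k, ∀ u ∈ K k, ∀ x, g k (u * x * u⁻¹) = g k x) ∧
      ∃ V ∈ 𝓝 (1 : (cmDatum L 2 (Matrix.of fun i j : Fin 2 => if i.val + j.val + 1 = 2 then (1 : L) else 0)).Local v ×
          (cmDatum L 1 (Matrix.of fun i j : Fin 1 => if i.val + j.val + 1 = 1 then (1 : L) else 0)).Local v),
        ∀ γH ∈ V, IsLocalGRegular L v γH →
          (∑ᶠ c : ConjClasses ((cmDatum L 3 H').Local v), T.Δ γH (Quotient.out c) * classOrbitalIntegral mG φ c) =
            ∑ k, ∑ᶠ c : ConjClasses ((cmDatum L 3 H').Local v), T.Δ γH (Quotient.out c) * classOrbitalIntegral mG (g k) c :=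
  span_of_cover L H' v w hw hH' hdet'
    (P := fun g => IsSelfDualLattice (galAdicCompletionMap (L := L) (IsCMField.complexConj L) hw) ϖ (placeForm H' w.1) (latt (g : Matrix (Fin 3) (Fin 3) (w.1.adicCompletion L))))
    (fun δ hδ => exists_isSelfDualLattice_mapGL_localNonsplitEquiv_eq_of_charpoly_of_neg L H' v w hw hH' hdet' hϖ hσϖ hres h2 hnorm A hc hA δ hδ)
    T hmG φ hφ

/-- **«SPAN-0-ram» RE-CENTRED AT `K_std`** (A-81 (1)(c) ∕ A-78): at a non-split place `v` TAMELY RAMIFIED in `L` — blocks (R), (F) (with `A ∈ GL₃(𝒪_w)`) as hypotheses — every `φ ∈ C_c^∞(U(H′)(L⁺_v))` has finitely many pieces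
`g k`, each smooth, supported in `K_std = cmLocalIntegralLevel L 3 H′ v` and `Ad(K_std)`-invariant, with `Σᶠ_c Δ(γH, out c)·Φ(c, φ) = Σ_k Σᶠ_c Δ·Φ(c, g k)` for all `G`-regular `γH`
near `1` (★ `span_isSelfDual`, re-centred by §1's `x_k` with `K_k = x_k K_std x_k⁻¹`; orbital integrals by ★ `classOrbitalIntegral_comp_conj` on the regular = `Δ ≠ 0` classes).
This is the END-contract stub «SPAN» WITHOUT `IsVertexStab`. [cite: Rogawski1990, §4.9 Lemma 4.9.3 p. 56] [cite: LanglandsShelstad1990Descent, §2.1] [cite: BruhatTits1972, §10] -/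
theorem span_isSelfDual_std_of_neg (hH' : (H'.map (cmConjRingHom L))ᵀ = H') (hdet' : H'.det ≠ 0)
    {ϖ : w.1.adicCompletion L} (hϖ : Valued.v ϖ = WithZero.exp (-1 : ℤ)) (hσϖ : galAdicCompletionMap (L := L) (IsCMField.complexConj L) hw ϖ = -ϖ)
    (hres : ∀ x : w.1.adicCompletion L, Valued.v x ≤ 1 → Valued.v (galAdicCompletionMap (L := L) (IsCMField.complexConj L) hw x - x) < 1) (h2 : Valued.v (2 : w.1.adicCompletion L) = 1)
    (hnorm : ∀ u : w.1.adicCompletion L, galAdicCompletionMap (L := L) (IsCMField.complexConj L) hw u = u → Valued.v (u - 1) < 1 →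
      ∃ z : w.1.adicCompletion L, z * galAdicCompletionMap (L := L) (IsCMField.complexConj L) hw z = u ∧ Valued.v (z - 1) ≤ Valued.v (u - 1))
    (A : GL (Fin 3) (w.1.adicCompletion L)) (hAint : A ∈ glInt 3 (w.1.adicCompletion L)) {c : w.1.adicCompletion L} (hc : Valued.v c = 1)
    (hA : placeForm H' w.1 = c • formCongr (galAdicCompletionMap (L := L) (IsCMField.complexConj L) hw) A ((StdForm.antidiagonal 3).over (w.1.adicCompletion L)))
    (T : LocalTransferFactor L H' v) {mG : OrbitalMeasureFamily ((cmDatum L 3 H').Local v)}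
    (hmG : mG.IsAdmissibleOn fun γ' => IsRegularElt (γ'.val : GL (Fin 3) (LocalRing L v)))
    (φ : (cmDatum L 3 H').Local v → ℂ) (hφ : IsLocSmooth φ) :
    ∃ (n : ℕ) (g : Fin n → (cmDatum L 3 H').Local v → ℂ),
      (∀ k, IsLocSmooth (g k)) ∧ (∀ k, tsupport (g k) ⊆ (cmLocalIntegralLevel L 3 H' v : Set ((cmDatum L 3 H').Local v))) ∧
      (∀ k, ∀ u ∈ cmLocalIntegralLevel L 3 H' v, ∀ x, g k (u * x * u⁻¹) = g k x) ∧
      ∃ V ∈ 𝓝 (1 : (cmDatum L 2 (Matrix.of fun i j : Fin 2 => if i.val + j.val + 1 = 2 then (1 : L) else 0)).Local v ×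
          (cmDatum L 1 (Matrix.of fun i j : Fin 1 => if i.val + j.val + 1 = 1 then (1 : L) else 0)).Local v),
        ∀ γH ∈ V, IsLocalGRegular L v γH →
          (∑ᶠ c : ConjClasses ((cmDatum L 3 H').Local v), T.Δ γH (Quotient.out c) * classOrbitalIntegral mG φ c) =
            ∑ k, ∑ᶠ c : ConjClasses ((cmDatum L 3 H').Local v), T.Δ γH (Quotient.out c) * classOrbitalIntegral mG (g k) c := by
  -- the one-place model, re-typed on the `cmDatum` carrier so that `map_mul` runs in one rendering of the group law (as in ★ `span_of_cover`)
  obtain ⟨E, hE⟩ : ∃ E : (cmDatum L 3 H').Local v ≃ₜ* ↥(unitaryGroupOfForm (galAdicCompletionMap (L := L) (IsCMField.complexConj L) hw) (placeForm H' w.1)),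
      ∀ g, ((E g : ↥(unitaryGroupOfForm (galAdicCompletionMap (L := L) (IsCMField.complexConj L) hw) (placeForm H' w.1))) : GL (Fin 3) (w.1.adicCompletion L)) =
        ((localNonsplitEquiv (IsCMField.complexConj L) H' (IsCMField.complexConj_ne_one L) w hw g :
          ↥(unitaryGroupOfForm (galAdicCompletionMap (L := L) (IsCMField.complexConj L) hw) (placeForm H' w.1))) : GL (Fin 3) (w.1.adicCompletion L)) :=
    ⟨localNonsplitEquiv (IsCMField.complexConj L) H' (IsCMField.complexConj_ne_one L) w hw, fun _ => rfl⟩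
  obtain ⟨n, K, g', hK, hsm, hts, hinv, V, hV, hsumΦ⟩ := span_isSelfDual_of_neg L H' v w hw hH' hdet' hϖ hσϖ hres h2 hnorm A hc hA T hmG φ hφ
  -- the self-dual vertices behind the stabilisers, and the re-centring elements `x k`
  choose gk hsd _hKc _hKo hKmem using hK
  have hx : ∀ k, ∃ x : (cmDatum L 3 H').Local v,
      mapGL ((localNonsplitEquiv (IsCMField.complexConj L) H' (IsCMField.complexConj_ne_one L) w hw x :
          ↥(unitaryGroupOfForm (galAdicCompletionMap (L := L) (IsCMField.complexConj L) hw) (placeForm H' w.1))) : GL (Fin 3) (w.1.adicCompletion L))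
        (stdLattice (w.1.adicCompletion L) 3) = latt (gk k : Matrix (Fin 3) (Fin 3) (w.1.adicCompletion L)) :=
    fun k => exists_local_mapGL_stdLattice_eq_of_isSelfDualLattice_of_frame L H' v w hw A hAint hc hA h2 (hsd k)
  choose x hxk using hx
  -- `K k = x_k K_std x_k⁻¹`, in the form we need: `x y x⁻¹ ∈ K k ↔ y ∈ K_std`
  have hconj : ∀ k (y : (cmDatum L 3 H').Local v), x k * y * (x k)⁻¹ ∈ K k ↔ y ∈ cmLocalIntegralLevel L 3 H' v := by
    intro k y
    rw [hKmem k, mem_cmLocalIntegralLevel_iff_mapGL_stdLattice_eq L H' v w hw, ← hxk k, ← hE (x k * y * (x k)⁻¹), map_mul, map_mul, map_inv,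
      Subgroup.coe_mul, Subgroup.coe_mul, Subgroup.coe_inv, hE, hE]
    exact mapGL_conj_mapGL_eq_iff _ _ _
  refine ⟨n, fun k y => g' k (x k * y * (x k)⁻¹), fun k => isLocSmooth_comp_conj (hsm k) (x k), fun k y hy => ?_, fun k u hu y => ?_, V, hV, fun γH hγV hγreg => ?_⟩
  · -- support in `K_std`
    exact (hconj k y).1 (hts k (tsupport_comp_conj_subset_preimage L H' v (g' k) (x k) y hy))
  · -- `Ad(K_std)`-invariance
    have hxu : x k * u * (x k)⁻¹ ∈ K k := (hconj k u).2 hu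
    have := hinv k _ hxu (x k * y * (x k)⁻¹)
    rw [show x k * u * (x k)⁻¹ * (x k * y * (x k)⁻¹) * (x k * u * (x k)⁻¹)⁻¹ = x k * (u * y * u⁻¹) * (x k)⁻¹ by group] at this
    exact this
  · -- the `Δ`-weighted sums, class by class
    rw [hsumΦ γH hγV hγreg]
    refine Finset.sum_congr rfl fun k _ => finsum_congr fun c => ?_
    by_cases hΔ : T.Δ γH (Quotient.out c) = 0
    · rw [hΔ, zero_mul, zero_mul]
    · have hR : IsLocalNormPair L H' v γH (Quotient.out c) := by
        by_contra hn; exact hΔ (T.eq_zero_of_not_rel _ _ hn)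
      rw [classOrbitalIntegral_comp_conj L H' v hmG c (isRegularElt_of_isLocalNormPair L H' v hR hγreg) (g' k) (x k)]

end Span

end Literature.NumberTheory.Rogawski1990

end
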